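import Summits.QuantumFields.YangMills.Theorems.BalabanLadderIRTwistedSlabCombesThomas
import Summits.QuantumFields.YangMills.Theorems.BalabanLadderIRTwistedSlabHodgeDeterminant
import HarnessLib

/-!
# The inverse Faddeev–Popov operator at the twist eater is exponentially localised, uniformly in the long extents
# (K43's Combes–Thomas estimate read on K8's bijective covariant Laplacian)

HELPER toward stub **T1** `TwistedSlabAnchor` of LINE `twisted-slab-continuity` (crux `IRcof`, stmt-QuantumFields-26930, census row 43;
LEAD prover ym-ir-line-tsc-p1 g6; `--supports` the crux, `--as helper`).  Theorems only.  K45 of the T1 programme = K43 (Combes–Thomas in weak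
form) ∘ K8 (`…HodgeDeterminant`: the Faddeev–Popov operator `Δ_U = Σ_μ (S_μ† − 1)(S_μ − 1)` on `tracelessFields`, BIJECTIVE at the twist-eating
ladder, `covLaplacian_traceless_bijective_ladder`):

* `hsRe_pair_covLaplacian` — the weak form of K8's operator: `Σ_x Re tr(χ(x)ᴴ (Δ_UΦ)(x)) = Σ_x Σ_μ Re tr((∇⁺_μχ)(x)ᴴ (∇⁺_μΦ)(x))` for all traceless
  `χ, Φ` (unitary background; K3a adjointness) — so every `Φ` IS a weak solution of `Δ_UΦ = J` with `J := Δ_UΦ`, and K43 applies;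
* ★★ `weighted_apriori_covLaplacian` — at a unitary background with 0-form gap `m` and an admissible weight (`(w(x+e_μ)−w(x))² ≤ κ w(x)w(x+e_μ)`,
  `4κ < m`): `(m − 4κ)²·Σ_x w(x)² S(Φ x) ≤ Σ_x w(x)² S(J x)` for EVERY traceless `Φ` with `Δ_UΦ = J`;
* ★★★ `ladder_inverse_covLaplacian_decay` — at the twist-eating ladder on `(m+1)² × n₂ × n₃` (`A B = ω B A`, `ω` primitive, the ladder unitary),
  for every `θ ≥ 0` with `8(cosh θ − 1) < g = 4sin²(π∕(N(m+1)))`, every `ρ` 1-Lipschitz along the links and EVERY traceless source `J`, the unique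
  traceless `Φ` with `Δ_UΦ = J` (K8) obeys `(g − 8(cosh θ − 1))²·Σ_x e^{2θρ(x)} S(Φ x) ≤ Σ_x e^{2θρ(x)} S(J x)`; ★ `ladder_inverse_covLaplacian_pointwise`
  — `e^{2θρ(x₀)} S(Φ x₀) ≤ (g − 8(cosh θ−1))⁻² Σ_x e^{2θρ(x)} S(J x)`: with `ρ = −d(·, x₀)` and `J` supported at `y`, `S((Δ⁻¹J)(x₀)) ≲ e^{−2θ d(x₀,y)} S(J y)`.
  Constants depend on `N, m, θ` ONLY — not on `n₂ = L`, `n₃ = t`.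

This is memo §16.3 (m3) in final form: the Green's function of the ghost ∕ Feynman-gauge operator at the twist eater decays exponentially with
an `L,t`-UNIFORM rate — the covariance input of any weak-coupling cluster expansion of the twisted tube.  HONEST FRAMING: tree-level linear algebra;
NOT the expansion; T1 (M4) 0∕1; IRcof ∕ IR 0∕1; the Yang–Mills mass gap (Clay) is NOT proved; R4 = `BalabanLadder.UV` only.
References: J.-M. Combes, L. Thomas, CMP 34 (1973) 251; M. García Pérez, A. González-Arroyo, M. Okawa, arXiv:1708.00841 §2.5.
-/

set_option autoImplicit false

noncomputable section

open scoped Matrix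
open Finset
open Literature.MathematicalPhysics.QuantumFieldTheory Literature.MathematicalPhysics.QuantumLattice
open Literature.Analysis.OperatorTheory

namespace Summit.QuantumFields.YangMills.Cruxes.IRcof.TwistedSlab

variable {N : ℕ} {n₀ n₁ n₂ n₃ : ℕ}

/-! ## §1 The weak form of K8's Faddeev–Popov operator -/

section Weak

variable {U : FinTorusSite n₀ n₁ n₂ n₃ × Fin 4 → Matrix (Fin N) (Fin N) ℂ}

/-- Symmetry of the real pairing (private twin of K3a's). [folklore] -/
private theorem hsRe_symm'' (X Y : Matrix (Fin N) (Fin N) ℂ) : ((Xᴴ * Y).trace).re = ((Yᴴ * X).trace).re := by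
  have h : Yᴴ * X = (Xᴴ * Y)ᴴ := by rw [Matrix.conjTranspose_mul, Matrix.conjTranspose_conjTranspose]
  rw [h, Matrix.trace_conjTranspose, Complex.star_def, Complex.conj_re]

/-- Pointwise form of K8's operator: `(Δ_UΦ)(x) = Σ_μ (S_μ†(∇⁺_μΦ)(x) − (∇⁺_μΦ)(x))`. [cite: GarciaperezGonzalezarroyoOkawa2017, §2.5] -/
theorem coe_covLaplacian_traceless_apply (hU : ∀ e, U e ∈ Matrix.unitaryGroup (Fin N) ℂ) (Φ : tracelessFields N n₀ n₁ n₂ n₃)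
    (x : FinTorusSite n₀ n₁ n₂ n₃) :
    ((DiscreteWeitzenboeck.covLaplacian (tracelessD hU) (tracelessDadj hU) Φ : tracelessFields N n₀ n₁ n₂ n₃) :
        FinTorusSite n₀ n₁ n₂ n₃ → Matrix (Fin N) (Fin N) ℂ) x =
      ∑ μ, (covShiftAdj U μ (covDeriv U μ Φ) x - covDeriv U μ Φ x) := by
  rw [DiscreteWeitzenboeck.covLaplacian_apply, Submodule.coe_sum, Finset.sum_apply]
  rfl

/-- ★ **Weak form**: `Σ_x Re tr(χ(x)ᴴ (Δ_UΦ)(x)) = Σ_x Σ_μ Re tr((∇⁺_μχ)(x)ᴴ (∇⁺_μΦ)(x))` for traceless `χ, Φ` at a unitary background.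
[cite: GarciaperezGonzalezarroyoOkawa2017, §2.5] -/
theorem hsRe_pair_covLaplacian (hU : ∀ e, U e ∈ Matrix.unitaryGroup (Fin N) ℂ) (χ Φ : tracelessFields N n₀ n₁ n₂ n₃) :
    ∑ x, ((((χ : FinTorusSite n₀ n₁ n₂ n₃ → Matrix (Fin N) (Fin N) ℂ) x)ᴴ *
        ((DiscreteWeitzenboeck.covLaplacian (tracelessD hU) (tracelessDadj hU) Φ : tracelessFields N n₀ n₁ n₂ n₃) :
          FinTorusSite n₀ n₁ n₂ n₃ → Matrix (Fin N) (Fin N) ℂ) x).trace).re =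
      ∑ x, ∑ μ, (((covDeriv U μ (χ : FinTorusSite n₀ n₁ n₂ n₃ → Matrix (Fin N) (Fin N) ℂ) x)ᴴ *
        covDeriv U μ (Φ : FinTorusSite n₀ n₁ n₂ n₃ → Matrix (Fin N) (Fin N) ℂ) x).trace).re := by
  simp only [coe_covLaplacian_traceless_apply hU, Finset.mul_sum, Matrix.trace_sum, Complex.re_sum]
  rw [Finset.sum_comm]
  conv_rhs => rw [Finset.sum_comm]
  refine Finset.sum_congr rfl fun μ _ => ?_
  -- `Σ_x Re tr(χᴴ (S†Ψ − Ψ)) = Σ_x Re tr((S†Ψ − Ψ)ᴴ χ) = Σ_x Re tr(Ψᴴ ∇χ) = Σ_x Re tr((∇χ)ᴴ Ψ)` with `Ψ = ∇⁺_μ Φ`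
  calc ∑ x, ((((χ : FinTorusSite n₀ n₁ n₂ n₃ → Matrix (Fin N) (Fin N) ℂ) x)ᴴ *
          (covShiftAdj U μ (covDeriv U μ Φ) x - covDeriv U μ Φ x)).trace).re
      = ∑ x, (((covShiftAdj U μ (covDeriv U μ Φ) x - covDeriv U μ Φ x)ᴴ *
          (χ : FinTorusSite n₀ n₁ n₂ n₃ → Matrix (Fin N) (Fin N) ℂ) x).trace).re :=
        Finset.sum_congr rfl fun x _ => hsRe_symm'' _ _
    _ = ∑ x, (((covDeriv U μ Φ x)ᴴ * covDeriv U μ (χ : FinTorusSite n₀ n₁ n₂ n₃ → Matrix (Fin N) (Fin N) ℂ) x).trace).re :=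
        sum_hsRe_covDerivAdj hU μ _ _
    _ = ∑ x, (((covDeriv U μ (χ : FinTorusSite n₀ n₁ n₂ n₃ → Matrix (Fin N) (Fin N) ℂ) x)ᴴ * covDeriv U μ Φ x).trace).re :=
        Finset.sum_congr rfl fun x _ => hsRe_symm'' _ _

/-- ★★ **Weighted a-priori bound for K8's operator**: at a unitary background with 0-form gap `m` on traceless fields and an admissible weight
`w > 0` (`(w(x+e_μ) − w(x))² ≤ κ·w(x)w(x+e_μ)`, `4κ < m`), EVERY traceless `Φ` satisfies
`(m − 4κ)²·Σ_x w(x)² S(Φ x) ≤ Σ_x w(x)² S((Δ_UΦ)(x))`. [cite: CombesThomas1973] [cite: GarciaperezGonzalezarroyoOkawa2017, §2.5] -/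
theorem weighted_apriori_covLaplacian (hU : ∀ e, U e ∈ Matrix.unitaryGroup (Fin N) ℂ) {m : ℝ}
    (hgap : ∀ Φ : FinTorusSite n₀ n₁ n₂ n₃ → Matrix (Fin N) (Fin N) ℂ, (∀ x, (Φ x).trace = 0) →
      m * ∑ x, (((Φ x)ᴴ * Φ x).trace).re ≤ ∑ x, ∑ μ, (((covDeriv U μ Φ x)ᴴ * covDeriv U μ Φ x).trace).re)
    {w : FinTorusSite n₀ n₁ n₂ n₃ → ℝ} (hw : ∀ x, 0 < w x) {κ : ℝ}
    (hκ : ∀ x μ, (w (x.shift μ) - w x) ^ 2 ≤ κ * (w x * w (x.shift μ))) (hmκ : 4 * κ < m)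
    (Φ J : tracelessFields N n₀ n₁ n₂ n₃) (hΦJ : DiscreteWeitzenboeck.covLaplacian (tracelessD hU) (tracelessDadj hU) Φ = J) :
    (m - 4 * κ) ^ 2 * ∑ x, w x ^ 2 * ((((Φ : FinTorusSite n₀ n₁ n₂ n₃ → Matrix (Fin N) (Fin N) ℂ) x)ᴴ *
        (Φ : FinTorusSite n₀ n₁ n₂ n₃ → Matrix (Fin N) (Fin N) ℂ) x).trace).re ≤
      ∑ x, w x ^ 2 * ((((J : FinTorusSite n₀ n₁ n₂ n₃ → Matrix (Fin N) (Fin N) ℂ) x)ᴴ *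
        (J : FinTorusSite n₀ n₁ n₂ n₃ → Matrix (Fin N) (Fin N) ℂ) x).trace).re := by
  refine weighted_apriori_of_weak_poisson hU hgap hw hκ hmκ _ _ Φ.2 fun χ hχ => ?_
  rw [← hsRe_pair_covLaplacian hU ⟨χ, hχ⟩ Φ, hΦJ]

end Weak

/-! ## §2 The twist-eating ladder: the inverse Faddeev–Popov operator decays, uniformly in `L, t` -/

section Ladder

variable [NeZero N] {A B : Matrix (Fin N) (Fin N) ℂ} {ω : ℂ} {m : ℕ}

/-- ★★★ **EXPONENTIAL LOCALISATION OF `Δ_U⁻¹` AT THE TWIST EATER, UNIFORMLY IN THE LONG EXTENTS.**  At the ladder `U = ladderField ![A, B, Γ₂, Γ₃]` on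
the box `(m+1)² × n₂ × n₃` (`A, B, Γ₂, Γ₃` unitary, `A B = ω B A`, `ω` a primitive `N`-th root of unity, `N(m+1) ≥ 2`): for `θ ≥ 0` with
`8(cosh θ − 1) < g := 4sin²(π∕(N(m+1)))`, every `ρ` with `|ρ(x+e_μ) − ρ(x)| ≤ 1`, and EVERY traceless source `J`, THE traceless solution `Φ` of
`Δ_UΦ = J` (it exists and is unique: K8 `covLaplacian_traceless_bijective_ladder`) satisfies
`(g − 8(cosh θ − 1))²·Σ_x e^{θρ(x)}² S(Φ x) ≤ Σ_x e^{θρ(x)}² S(J x)`.  The constants see `N, m, θ` only. [cite: CombesThomas1973]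
[cite: GarciaperezGonzalezarroyoOkawa2017, §2.5] -/
theorem ladder_inverse_covLaplacian_decay (hAu : A ∈ Matrix.unitaryGroup (Fin N) ℂ) (hBu : B ∈ Matrix.unitaryGroup (Fin N) ℂ)
    (hω : IsPrimitiveRoot ω N) (hAB : A * B = ω • (B * A)) {Γ₂ Γ₃ : Matrix (Fin N) (Fin N) ℂ}
    (hU : ∀ e, ladderField (n₀ := m + 1) (n₁ := m + 1) (n₂ := n₂) (n₃ := n₃) ![A, B, Γ₂, Γ₃] e ∈ Matrix.unitaryGroup (Fin N) ℂ)
    {θ : ℝ} (hθ : 0 ≤ θ) (hθg : 8 * (Real.cosh θ - 1) < 4 * Real.sin (Real.pi / ((N : ℝ) * (m + 1 : ℕ))) ^ 2)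
    {ρ : FinTorusSite (m + 1) (m + 1) n₂ n₃ → ℝ} (hρ : ∀ x μ, |ρ (x.shift μ) - ρ x| ≤ 1)
    (Φ J : tracelessFields N (m + 1) (m + 1) n₂ n₃)
    (hΦJ : DiscreteWeitzenboeck.covLaplacian (tracelessD hU) (tracelessDadj hU) Φ = J) :
    (4 * Real.sin (Real.pi / ((N : ℝ) * (m + 1 : ℕ))) ^ 2 - 8 * (Real.cosh θ - 1)) ^ 2 *
        ∑ x, Real.exp (θ * ρ x) ^ 2 * ((((Φ : FinTorusSite (m + 1) (m + 1) n₂ n₃ → Matrix (Fin N) (Fin N) ℂ) x)ᴴ *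
          (Φ : FinTorusSite (m + 1) (m + 1) n₂ n₃ → Matrix (Fin N) (Fin N) ℂ) x).trace).re ≤
      ∑ x, Real.exp (θ * ρ x) ^ 2 * ((((J : FinTorusSite (m + 1) (m + 1) n₂ n₃ → Matrix (Fin N) (Fin N) ℂ) x)ᴴ *
          (J : FinTorusSite (m + 1) (m + 1) n₂ n₃ → Matrix (Fin N) (Fin N) ℂ) x).trace).re := by
  have hgap := fun (Ψ : FinTorusSite (m + 1) (m + 1) n₂ n₃ → Matrix (Fin N) (Fin N) ℂ) (hΨ : ∀ x, (Ψ x).trace = 0) =>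
    zeroForm_gap_ladder (n₂ := n₂) (n₃ := n₃) hAu hBu hω hAB Γ₂ Γ₃ Ψ hΨ
  have hκ := fun x μ => exp_weight_admissible (n₀ := m + 1) (n₁ := m + 1) (n₂ := n₂) (n₃ := n₃) hρ hθ x μ
  have h := weighted_apriori_covLaplacian hU hgap (w := fun x => Real.exp (θ * ρ x)) (fun x => Real.exp_pos (θ * ρ x))
    (κ := 2 * (Real.cosh θ - 1)) hκ (by linarith) Φ J hΦJ
  have e : 4 * Real.sin (Real.pi / ((N : ℝ) * (m + 1 : ℕ))) ^ 2 - 4 * (2 * (Real.cosh θ - 1)) =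
      4 * Real.sin (Real.pi / ((N : ℝ) * (m + 1 : ℕ))) ^ 2 - 8 * (Real.cosh θ - 1) := by ring
  rw [e] at h
  exact h

/-- ★ **Pointwise form** (the Green's function): under the same hypotheses, at every site `x₀`,
`e^{θρ(x₀)}²·S(Φ x₀) ≤ (g − 8(cosh θ − 1))⁻²·Σ_x e^{θρ(x)}² S(J x)` — for `J` supported at one site `y` and `ρ = −d(·, y)` this is the decay
`S((Δ_U⁻¹J)(x₀)) ≤ K e^{−2θ d(x₀,y)} S(J y)` with `K, θ` independent of `L, t`. [cite: CombesThomas1973] [cite: GarciaperezGonzalezarroyoOkawa2017, §2.5] -/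
theorem ladder_inverse_covLaplacian_pointwise (hAu : A ∈ Matrix.unitaryGroup (Fin N) ℂ) (hBu : B ∈ Matrix.unitaryGroup (Fin N) ℂ)
    (hω : IsPrimitiveRoot ω N) (hAB : A * B = ω • (B * A)) {Γ₂ Γ₃ : Matrix (Fin N) (Fin N) ℂ}
    (hU : ∀ e, ladderField (n₀ := m + 1) (n₁ := m + 1) (n₂ := n₂) (n₃ := n₃) ![A, B, Γ₂, Γ₃] e ∈ Matrix.unitaryGroup (Fin N) ℂ)
    {θ : ℝ} (hθ : 0 ≤ θ) (hθg : 8 * (Real.cosh θ - 1) < 4 * Real.sin (Real.pi / ((N : ℝ) * (m + 1 : ℕ))) ^ 2)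
    {ρ : FinTorusSite (m + 1) (m + 1) n₂ n₃ → ℝ} (hρ : ∀ x μ, |ρ (x.shift μ) - ρ x| ≤ 1)
    (Φ J : tracelessFields N (m + 1) (m + 1) n₂ n₃)
    (hΦJ : DiscreteWeitzenboeck.covLaplacian (tracelessD hU) (tracelessDadj hU) Φ = J) (x₀ : FinTorusSite (m + 1) (m + 1) n₂ n₃) :
    Real.exp (θ * ρ x₀) ^ 2 * ((((Φ : FinTorusSite (m + 1) (m + 1) n₂ n₃ → Matrix (Fin N) (Fin N) ℂ) x₀)ᴴ *
        (Φ : FinTorusSite (m + 1) (m + 1) n₂ n₃ → Matrix (Fin N) (Fin N) ℂ) x₀).trace).re ≤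
      ((4 * Real.sin (Real.pi / ((N : ℝ) * (m + 1 : ℕ))) ^ 2 - 8 * (Real.cosh θ - 1)) ^ 2)⁻¹ *
        ∑ x, Real.exp (θ * ρ x) ^ 2 * ((((J : FinTorusSite (m + 1) (m + 1) n₂ n₃ → Matrix (Fin N) (Fin N) ℂ) x)ᴴ *
          (J : FinTorusSite (m + 1) (m + 1) n₂ n₃ → Matrix (Fin N) (Fin N) ℂ) x).trace).re := by
  have h := ladder_inverse_covLaplacian_decay hAu hBu hω hAB hU hθ hθg hρ Φ J hΦJ
  have hpos : 0 < (4 * Real.sin (Real.pi / ((N : ℝ) * (m + 1 : ℕ))) ^ 2 - 8 * (Real.cosh θ - 1)) ^ 2 := by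
    have : 0 < 4 * Real.sin (Real.pi / ((N : ℝ) * (m + 1 : ℕ))) ^ 2 - 8 * (Real.cosh θ - 1) := by linarith
    positivity
  have hsingle : Real.exp (θ * ρ x₀) ^ 2 * ((((Φ : FinTorusSite (m + 1) (m + 1) n₂ n₃ → Matrix (Fin N) (Fin N) ℂ) x₀)ᴴ *
        (Φ : FinTorusSite (m + 1) (m + 1) n₂ n₃ → Matrix (Fin N) (Fin N) ℂ) x₀).trace).re ≤
      ∑ x, Real.exp (θ * ρ x) ^ 2 * ((((Φ : FinTorusSite (m + 1) (m + 1) n₂ n₃ → Matrix (Fin N) (Fin N) ℂ) x)ᴴ *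
        (Φ : FinTorusSite (m + 1) (m + 1) n₂ n₃ → Matrix (Fin N) (Fin N) ℂ) x).trace).re :=
    Finset.single_le_sum (f := fun x => Real.exp (θ * ρ x) ^ 2 *
        ((((Φ : FinTorusSite (m + 1) (m + 1) n₂ n₃ → Matrix (Fin N) (Fin N) ℂ) x)ᴴ *
          (Φ : FinTorusSite (m + 1) (m + 1) n₂ n₃ → Matrix (Fin N) (Fin N) ℂ) x).trace).re)
      (fun x _ => mul_nonneg (sq_nonneg _) (re_trace_conjTranspose_mul_self_nonneg _)) (Finset.mem_univ x₀)
  rw [le_inv_mul_iff₀ hpos]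
  exact (mul_le_mul_of_nonneg_left hsingle hpos.le).trans h

/-- ★★ **Existence + decay packaged**: at the ladder (same hypotheses, `N(m+1) ≥ 2`), every traceless source `J` has a UNIQUE traceless `Φ` with
`Δ_UΦ = J`, and it obeys the uniform weighted bound. [cite: GarciaperezGonzalezarroyoOkawa2017, §2.5] [cite: CombesThomas1973] -/
theorem ladder_green_exists_unique_decay (hAu : A ∈ Matrix.unitaryGroup (Fin N) ℂ) (hBu : B ∈ Matrix.unitaryGroup (Fin N) ℂ)
    (hω : IsPrimitiveRoot ω N) (hAB : A * B = ω • (B * A)) {Γ₂ Γ₃ : Matrix (Fin N) (Fin N) ℂ} (hNm : 2 ≤ N * (m + 1))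
    (hU : ∀ e, ladderField (n₀ := m + 1) (n₁ := m + 1) (n₂ := n₂) (n₃ := n₃) ![A, B, Γ₂, Γ₃] e ∈ Matrix.unitaryGroup (Fin N) ℂ)
    {θ : ℝ} (hθ : 0 ≤ θ) (hθg : 8 * (Real.cosh θ - 1) < 4 * Real.sin (Real.pi / ((N : ℝ) * (m + 1 : ℕ))) ^ 2)
    {ρ : FinTorusSite (m + 1) (m + 1) n₂ n₃ → ℝ} (hρ : ∀ x μ, |ρ (x.shift μ) - ρ x| ≤ 1)
    (J : tracelessFields N (m + 1) (m + 1) n₂ n₃) :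
    ∃! Φ : tracelessFields N (m + 1) (m + 1) n₂ n₃, DiscreteWeitzenboeck.covLaplacian (tracelessD hU) (tracelessDadj hU) Φ = J ∧
      (4 * Real.sin (Real.pi / ((N : ℝ) * (m + 1 : ℕ))) ^ 2 - 8 * (Real.cosh θ - 1)) ^ 2 *
          ∑ x, Real.exp (θ * ρ x) ^ 2 * ((((Φ : FinTorusSite (m + 1) (m + 1) n₂ n₃ → Matrix (Fin N) (Fin N) ℂ) x)ᴴ *
            (Φ : FinTorusSite (m + 1) (m + 1) n₂ n₃ → Matrix (Fin N) (Fin N) ℂ) x).trace).re ≤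
        ∑ x, Real.exp (θ * ρ x) ^ 2 * ((((J : FinTorusSite (m + 1) (m + 1) n₂ n₃ → Matrix (Fin N) (Fin N) ℂ) x)ᴴ *
            (J : FinTorusSite (m + 1) (m + 1) n₂ n₃ → Matrix (Fin N) (Fin N) ℂ) x).trace).re := by
  have hbij := covLaplacian_traceless_bijective_ladder (n₂' := n₂) (n₃' := n₃) hAu hBu hω hAB (Γ₂ := Γ₂) (Γ₃ := Γ₃) hNm hU
  obtain ⟨Φ, hΦ⟩ := hbij.2 J
  refine ⟨Φ, ⟨hΦ, ladder_inverse_covLaplacian_decay hAu hBu hω hAB hU hθ hθg hρ Φ J hΦ⟩, fun Ψ hΨ => ?_⟩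
  exact hbij.1 (hΨ.1.trans hΦ.symm)

end Ladder

end Summit.QuantumFields.YangMills.Cruxes.IRcof.TwistedSlab

end
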